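import Mathlib
import HarnessLib.Audit
import Summits.PneNP.PneNP.Theorems.PstarCentreGateBudgetParts

/-!
# The gate budget over the parts: cover, dirty-chord, slack and size corollaries (ROUND-24, O1; memo g25 §54)

FRONTIER range-avoidance ladder, rung F-N3, ROUND 24 (cell `pnp-ideate`, prover-2 memo `g25/O1-XORSPLIT-g25.md` §54; typed targets
`PstarCoreBoundTargets.TerminalFive` / `TerminalPeelable` (p646951); restricted-model proof complexity — nothing here bears on `P` versus `NP`).

The corollaries of `PstarCentreGateBudget` (X-connected cores) for ARBITRARY terminal cores with a centre, from
`PstarCentreGateBudgetParts.centre_gate_budget_parts`; `p₀ := #{P ∈ parts : P ∩ S = ∅}` the centre-free parts of a partition into separated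
X-connected parts (inside the core-bound induction, every slack, all sharing patterns):

* `card_centre_add_le_card_cover_parts` — every inside-gate cover of the dirty chords has `≥ #S + 2·#N₀ − 2·p₀` gates;
* `card_centre_add_le_card_dirty_parts` — `#S + 2·#N₀ ≤ #dirty + 2·p₀`;
* `slack_ge_centre_parts` — `3·#K + #S + 2·#N₀ ≤ 2·#bdry K + 2·p₀`;
* `three_mul_card_centre_le_card_parts` — `3·#S + 4·#N₀ ≤ #K + 2·p₀`.
-/

set_option linter.dupNamespace false -- `Summit.PneNP.PneNP.…`: summit = sub-problem name (D-0017 single-conjunct layout)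

open Finset Literature.Computability.Complexity
open Summit.PneNP.PneNP.Theorems.PstarTyped (Typed)
open Summit.PneNP.PneNP.Theorems.PstarSALevel (varSet bdry BoundaryExpanding SimpleOverlap)
open Summit.PneNP.PneNP.Theorems.PstarSAClosure (degIn mem_bdry_iff)
open Summit.PneNP.PneNP.Theorems.PstarXCore (xpair mem_xpair xverts)
open Summit.PneNP.PneNP.Theorems.PstarCentreFree (vars_mem_varSet)
open Summit.PneNP.PneNP.Theorems.PstarCoreBound (XorClosed)
open Summit.PneNP.PneNP.Theorems.PstarChordRepair (IsChord)
open Summit.PneNP.PneNP.Theorems.PstarCoreBoundTargets (Terminal nonchords mem_nonchords)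
open Summit.PneNP.PneNP.Theorems.PstarSharingBound (sharedSlots card_bdry_add_card_sharedSlots_le)
open Summit.PneNP.PneNP.Theorems.PstarChordBridgeTools (xpdeg)
open Summit.PneNP.PneNP.Theorems.PstarChordBridgeExchange (mem_xverts_iff)
open Summit.PneNP.PneNP.Theorems.PstarNorUnitCoverTools (exists_ne_of_two_le_xpdeg)
open Summit.PneNP.PneNP.Theorems.PstarChordReadOutside (OutsideGated)
open Summit.PneNP.PneNP.Theorems.PstarNoFreeVertex (covered_of_terminal mem_varSet_of_mem_xpair mem_xpair_of_mem_varSet)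
open Summit.PneNP.PneNP.Theorems.PstarSkeletonSpan (XConnected)
open Summit.PneNP.PneNP.Theorems.PstarSlackTools (three_le_card_xverts_of_leafless)
open Summit.PneNP.PneNP.Theorems.PstarSlackTwoTools (card_deg2_chords_le_filter exists_inside_gate not_mem_varSet_gate_of_clean)
open Summit.PneNP.PneNP.Theorems.PstarSlackTwoClean (card_bdry_sdiff_add_le)

open Summit.PneNP.PneNP.Theorems.PstarCentreThreeGates (degIn_union card_bdry_union_le isChord_union_of_clean)
open Summit.PneNP.PneNP.Theorems.PstarGateBudgetTools (card_nonchords_add_le_card_sharedSlots)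
open Summit.PneNP.PneNP.Theorems.PstarCentreGateBudgetParts (centre_gate_budget_parts)

namespace Summit.PneNP.PneNP.Theorems.PstarCentreGateBudgetPartsCover

variable {n m : ℕ}

variable {I : LocalMap 4 n m} {r : ℕ} {y : Fin m → Bool} {K : Finset (Fin m)} {w₁ w₂ : Finset (Fin n) × Finset (Fin m) × Bool}

/-- **Every inside-gate cover of the dirty chords has at least `#S + 2·#N₀ − 2·#{centre-free parts}` gates.** -/
theorem card_centre_add_le_card_cover_parts (hI : I.IsPure xorAndPred) (hT : Typed I) (hS : SimpleOverlap I) (hB : BoundaryExpanding r I)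
    (ht : Terminal I r y K w₁ w₂)
    (hIH : ∀ c ∈ K, ∀ K₀ ⊆ K.erase c, ∀ d d' : Finset (Fin n) × Finset (Fin m) × Bool, Terminal I r y K₀ d d' → K₀.card ≤ 5)
    (parts : Finset (Finset (Fin m))) (hpK : ∀ P ∈ parts, P ⊆ K) (hpcov : ∀ f ∈ K, ∃ P ∈ parts, f ∈ P)
    (hpdisj : ∀ P ∈ parts, ∀ P' ∈ parts, P ≠ P' → Disjoint P P')
    (hpsep : ∀ P ∈ parts, ∀ f ∈ K, f ∉ P → I.vars f 0 ∉ xverts I P ∧ I.vars f 1 ∉ xverts I P)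
    (hpconn : ∀ P ∈ parts, XConnected I P) {S : Finset (Fin m)} (hSK : S ⊆ K) (hSne : S.Nonempty) (hSL : ∀ w ∈ xverts I S, 2 ≤ xpdeg I S w)
    (hSnc : ∀ f ∈ S, ¬ IsChord I K f) {H : Finset (Fin m)} (hHM : H ⊆ w₁.2.1 ∪ w₂.2.1)
    (hHin : ∀ h ∈ H, (∃ j ∈ K, I.vars h 2 ∈ varSet I j) ∧ ∃ j ∈ K, I.vars h 3 ∈ varSet I j)
    (hcover : ∀ d ∈ K, IsChord I K d → ¬ OutsideGated I K (w₁.2.1 ∪ w₂.2.1) d →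
      ∃ h ∈ H, I.vars d 2 ∈ varSet I h ∨ I.vars d 3 ∈ varSet I h)
    {N₀ : Finset (Fin m)} (hN₀K : N₀ ⊆ K) (hN₀ : ∀ f ∈ N₀, I.vars f 2 ∉ bdry I K ∧ I.vars f 3 ∉ bdry I K) :
    S.card + 2 * N₀.card ≤ H.card + 2 * (parts.filter fun P => P ∩ S = ∅).card := by
  classical
  set D := K.filter fun c => IsChord I K c ∧ ¬ OutsideGated I K (w₁.2.1 ∪ w₂.2.1) c with hDdef
  have hbud := centre_gate_budget_parts hI hT hS hB ht hIH parts hpK hpcov hpdisj hpsep hpconn hSK hSne hSL hSnc hHM hHin (D := D)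
    (fun d hd hch hO => mem_filter.2 ⟨hd, hch, hO⟩) hN₀K hN₀
  have hdisj : Disjoint K (w₁.2.1 ∪ w₂.2.1) := disjoint_union_right.2 ⟨ht.2.2.2.1, ht.2.2.2.2.1⟩
  have hKH : Disjoint K H := hdisj.mono_right hHM
  -- one covered private slot per dirty chord leaves the boundary of `K ∪ H`
  have hVex : ∀ d ∈ D, ∃ v, (v = I.vars d 2 ∨ v = I.vars d 3) ∧ ∃ h ∈ H, v ∈ varSet I h := fun d hd => by
    obtain ⟨hdK, hch, hO⟩ := mem_filter.1 hd
    obtain ⟨h, hh, h23⟩ := hcover d hdK hch hO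
    rcases h23 with h2 | h3
    · exact ⟨_, Or.inl rfl, h, hh, h2⟩
    · exact ⟨_, Or.inr rfl, h, hh, h3⟩
  choose ν hν23 hνH using hVex
  set vf : Fin m → Fin n := fun d => if h : d ∈ D then ν d h else I.vars d 2 with hvf
  have hvfD : ∀ d (hd : d ∈ D), vf d = ν d hd := fun d hd => by simp only [hvf, dif_pos hd]
  have hvbd : ∀ d ∈ D, vf d ∈ bdry I K ∧ vf d ∈ varSet I d := fun d hd => by
    obtain ⟨hdK, hch, -⟩ := mem_filter.1 hd
    rw [hvfD d hd]
    rcases hν23 d hd with h | h <;> rw [h]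
    · exact ⟨hch.1, vars_mem_varSet I d 2⟩
    · exact ⟨hch.2, vars_mem_varSet I d 3⟩
  set V := D.image vf with hVdef
  have hVb : V ⊆ bdry I K := fun v hv => by
    obtain ⟨d, hd, rfl⟩ := mem_image.1 hv
    exact (hvbd d hd).1
  have hVH : ∀ v ∈ V, ∃ h ∈ H, v ∈ varSet I h := fun v hv => by
    obtain ⟨d, hd, rfl⟩ := mem_image.1 hv
    rw [hvfD d hd]
    exact hνH d hd
  have hVcard : V.card = D.card := by
    refine card_image_of_injOn fun d hd d' hd' h => ?_
    have hd₀ : d ∈ D := mem_coe.1 hd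
    have hd₀' : d' ∈ D := mem_coe.1 hd'
    by_contra hne
    have hb := (hvbd d hd₀).1
    rw [mem_bdry_iff] at hb
    unfold PstarSAClosure.degIn at hb
    have two : ({d, d'} : Finset (Fin m)) ⊆ K.filter fun j => vf d ∈ varSet I j := by
      intro j hj
      rcases mem_insert.1 hj with rfl | hj
      · exact mem_filter.2 ⟨(mem_filter.1 hd₀).1, (hvbd j hd₀).2⟩
      · rw [mem_singleton.1 hj]
        exact mem_filter.2 ⟨(mem_filter.1 hd₀').1, h ▸ (hvbd d' hd₀').2⟩
    have := card_le_card two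
    rw [card_pair hne] at this
    omega
  have hbF := card_bdry_union_le I hKH hHin hVb hVH
  omega

/-- **The dirty chords number at least `#S + 2·#N₀ − 2·#{centre-free parts}`.** -/
theorem card_centre_add_le_card_dirty_parts (hI : I.IsPure xorAndPred) (hT : Typed I) (hS : SimpleOverlap I) (hB : BoundaryExpanding r I)
    (ht : Terminal I r y K w₁ w₂)
    (hIH : ∀ c ∈ K, ∀ K₀ ⊆ K.erase c, ∀ d d' : Finset (Fin n) × Finset (Fin m) × Bool, Terminal I r y K₀ d d' → K₀.card ≤ 5)
    (parts : Finset (Finset (Fin m))) (hpK : ∀ P ∈ parts, P ⊆ K) (hpcov : ∀ f ∈ K, ∃ P ∈ parts, f ∈ P)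
    (hpdisj : ∀ P ∈ parts, ∀ P' ∈ parts, P ≠ P' → Disjoint P P')
    (hpsep : ∀ P ∈ parts, ∀ f ∈ K, f ∉ P → I.vars f 0 ∉ xverts I P ∧ I.vars f 1 ∉ xverts I P)
    (hpconn : ∀ P ∈ parts, XConnected I P) {S : Finset (Fin m)} (hSK : S ⊆ K) (hSne : S.Nonempty) (hSL : ∀ w ∈ xverts I S, 2 ≤ xpdeg I S w)
    (hSnc : ∀ f ∈ S, ¬ IsChord I K f)
    {D : Finset (Fin m)} (hD : ∀ d ∈ K, IsChord I K d → ¬ OutsideGated I K (w₁.2.1 ∪ w₂.2.1) d → d ∈ D)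
    {N₀ : Finset (Fin m)} (hN₀K : N₀ ⊆ K) (hN₀ : ∀ f ∈ N₀, I.vars f 2 ∉ bdry I K ∧ I.vars f 3 ∉ bdry I K) :
    S.card + 2 * N₀.card ≤ D.card + 2 * (parts.filter fun P => P ∩ S = ∅).card := by
  classical
  have hdisj : Disjoint K (w₁.2.1 ∪ w₂.2.1) := disjoint_union_right.2 ⟨ht.2.2.2.1, ht.2.2.2.2.1⟩
  set D' := D.filter fun d => d ∈ K ∧ IsChord I K d ∧ ¬ OutsideGated I K (w₁.2.1 ∪ w₂.2.1) d with hD'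
  have hg : ∀ d ∈ D', ∃ g ∈ w₁.2.1 ∪ w₂.2.1, ((∃ j ∈ K, I.vars g 2 ∈ varSet I j) ∧ ∃ j ∈ K, I.vars g 3 ∈ varSet I j) ∧
      (I.vars d 2 ∈ varSet I g ∨ I.vars d 3 ∈ varSet I g) := fun d hd => by
    obtain ⟨-, hdK, hch, hO⟩ := mem_filter.1 hd
    obtain ⟨g, hgM, -, hg2, hg3, v, hv, hvg, -⟩ := exists_inside_gate I hdisj hdK hch hO
    refine ⟨g, hgM, ⟨hg2, hg3⟩, ?_⟩
    rcases hv with rfl | rfl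
    · exact Or.inl hvg
    · exact Or.inr hvg
  choose γ hγM hγin hγd using hg
  obtain ⟨d₀, -⟩ := ht.1
  set gf : Fin m → Fin m := fun d => if h : d ∈ D' then γ d h else d₀ with hgf
  have h := card_centre_add_le_card_cover_parts hI hT hS hB ht hIH parts hpK hpcov hpdisj hpsep hpconn hSK hSne hSL hSnc
    (H := D'.image gf) (fun g hg' => ?_) (fun g hg' => ?_) (fun d hdK hch hO => ?_) hN₀K hN₀
  · exact h.trans (Nat.add_le_add_right (card_image_le.trans (card_filter_le _ _)) _)
  · obtain ⟨d, hd, rfl⟩ := mem_image.1 hg'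
    simp only [hgf, dif_pos hd]
    exact hγM d hd
  · obtain ⟨d, hd, rfl⟩ := mem_image.1 hg'
    simp only [hgf, dif_pos hd]
    exact hγin d hd
  · have hd : d ∈ D' := mem_filter.2 ⟨hD d hdK hch hO, hdK, hch, hO⟩
    refine ⟨gf d, mem_image_of_mem _ hd, ?_⟩
    simp only [hgf, dif_pos hd]
    exact hγd d hd

/-- **Slack**: `3·#K + #S + 2·#N₀ ≤ 2·#bdry K + 2·#{centre-free parts}` (with `card_dirty_le_slack`). -/
theorem slack_ge_centre_parts (hI : I.IsPure xorAndPred) (hT : Typed I) (hS : SimpleOverlap I) (hB : BoundaryExpanding r I)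
    (ht : Terminal I r y K w₁ w₂)
    (hIH : ∀ c ∈ K, ∀ K₀ ⊆ K.erase c, ∀ d d' : Finset (Fin n) × Finset (Fin m) × Bool, Terminal I r y K₀ d d' → K₀.card ≤ 5)
    (parts : Finset (Finset (Fin m))) (hpK : ∀ P ∈ parts, P ⊆ K) (hpcov : ∀ f ∈ K, ∃ P ∈ parts, f ∈ P)
    (hpdisj : ∀ P ∈ parts, ∀ P' ∈ parts, P ≠ P' → Disjoint P P')
    (hpsep : ∀ P ∈ parts, ∀ f ∈ K, f ∉ P → I.vars f 0 ∉ xverts I P ∧ I.vars f 1 ∉ xverts I P)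
    (hpconn : ∀ P ∈ parts, XConnected I P) {S : Finset (Fin m)} (hSK : S ⊆ K) (hSne : S.Nonempty) (hSL : ∀ w ∈ xverts I S, 2 ≤ xpdeg I S w)
    (hSnc : ∀ f ∈ S, ¬ IsChord I K f)
    {N₀ : Finset (Fin m)} (hN₀K : N₀ ⊆ K) (hN₀ : ∀ f ∈ N₀, I.vars f 2 ∉ bdry I K ∧ I.vars f 3 ∉ bdry I K) :
    3 * K.card + S.card + 2 * N₀.card ≤ 2 * (bdry I K).card + 2 * (parts.filter fun P => P ∩ S = ∅).card := by
  classical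
  set D := K.filter fun c => IsChord I K c ∧ ¬ OutsideGated I K (w₁.2.1 ∪ w₂.2.1) c with hDdef
  have h1 := card_centre_add_le_card_dirty_parts hI hT hS hB ht hIH parts hpK hpcov hpdisj hpsep hpconn hSK hSne hSL hSnc (D := D)
    (fun d hd hch hO => mem_filter.2 ⟨hd, hch, hO⟩) hN₀K hN₀
  have hexp : 3 * K.card ≤ 2 * (bdry I K).card := hB K ht.2.2.1.le
  obtain ⟨t, ht'⟩ : ∃ t, 2 * (bdry I K).card = 3 * K.card + t := ⟨2 * (bdry I K).card - 3 * K.card, by omega⟩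
  have h2 := PstarChordReadTwoCleanCount.card_dirty_le_slack hB ht ht'.le (𝒟 := D) (filter_subset _ _)
    (fun d hd => (mem_filter.1 hd).2.1) (fun d hd => (mem_filter.1 hd).2.2)
  omega

/-- **Size**: `3·#S + 4·#N₀ ≤ #K + 2·#{centre-free parts}`. -/
theorem three_mul_card_centre_le_card_parts (hI : I.IsPure xorAndPred) (hT : Typed I) (hS : SimpleOverlap I) (hB : BoundaryExpanding r I)
    (ht : Terminal I r y K w₁ w₂)
    (hIH : ∀ c ∈ K, ∀ K₀ ⊆ K.erase c, ∀ d d' : Finset (Fin n) × Finset (Fin m) × Bool, Terminal I r y K₀ d d' → K₀.card ≤ 5)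
    (parts : Finset (Finset (Fin m))) (hpK : ∀ P ∈ parts, P ⊆ K) (hpcov : ∀ f ∈ K, ∃ P ∈ parts, f ∈ P)
    (hpdisj : ∀ P ∈ parts, ∀ P' ∈ parts, P ≠ P' → Disjoint P P')
    (hpsep : ∀ P ∈ parts, ∀ f ∈ K, f ∉ P → I.vars f 0 ∉ xverts I P ∧ I.vars f 1 ∉ xverts I P)
    (hpconn : ∀ P ∈ parts, XConnected I P) {S : Finset (Fin m)} (hSK : S ⊆ K) (hSne : S.Nonempty) (hSL : ∀ w ∈ xverts I S, 2 ≤ xpdeg I S w)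
    (hSnc : ∀ f ∈ S, ¬ IsChord I K f)
    {N₀ : Finset (Fin m)} (hN₀K : N₀ ⊆ K) (hN₀ : ∀ f ∈ N₀, I.vars f 2 ∉ bdry I K ∧ I.vars f 3 ∉ bdry I K) :
    3 * S.card + 4 * N₀.card ≤ K.card + 2 * (parts.filter fun P => P ∩ S = ∅).card := by
  have h1 := slack_ge_centre_parts hI hT hS hB ht hIH parts hpK hpcov hpdisj hpsep hpconn hSK hSne hSL hSnc hN₀K hN₀
  have h2 := card_bdry_add_card_sharedSlots_le I K ht.2.1
  have h3 := card_nonchords_add_le_card_sharedSlots I K hN₀K hN₀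
  have h4 : S.card ≤ (nonchords I K).card := card_le_card fun f hf => (mem_nonchords I).2 ⟨hSK hf, hSnc f hf⟩
  omega

end Summit.PneNP.PneNP.Theorems.PstarCentreGateBudgetPartsCover
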